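import Summits.NavierStokesRegularity.NavierStokesRegularity.Theorems.ExtremiserTransienceDissipationLedgerUnitScale
import Summits.NavierStokesRegularity.NavierStokesRegularity.Theorems.ExtremiserTransienceTightOrChainDefs
import Literature.Analysis.FluidPDE.TypeIAncientMildRescale
import Mathlib.MeasureTheory.Measure.Haar.NormedSpace
import HarnessLib

/-!
# Dissipation ledger (LINES g10-α/β/γ, crux 26567) — stubs L1 `stub_dissipationBudget` and L1ᵘ `stub_uniformDissipationBudget` PROVED

The dissipation-budget stubs of the g10 lines on crux `NearExtremalTransiencePerFlow` (stmt-NavierStokesRegularity-26567), BY NAME over the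
texts of record (`Theorems/ExtremiserTransienceDissipationLedgerDefs.lean`, `Theorems/ExtremiserTransienceTightOrChainDefs.lean`):

  `stub_dissipationBudget : DissipationBudget` (L1 of LINE g10-α `dissipation_ledger`) and
  `stub_uniformDissipationBudget : UniformDissipationBudget` (L1ᵘ of LINES g10-β `tight_or_chain` / g10-γ `multiscale_crowding`, the
  registered stub of the skeleton of record) — a Type-I ancient mild field `W` (`IsTypeIAncientMild K W`) with all-time linear local-energy
  growth `A` (`HasLinGrowthAllTime A W`) dissipates at most `E·R` in every parabolic cylinder `[τ₁,τ₂] × B(x,R)` with `−τ₁ ≤ R²`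
  (`τ₁ < τ₂ < 0`), with `E = C_u (A + K A + A√A)` depending on `K, A` ONLY (`C_u` absolute) — which is the uniform form L1ᵘ.

Reduction to the unit cylinder of the sibling file (`unitCylinder_dissipationIntegral_le`) by the symmetries of the class: the
zoom-translate `V(s,y) = R·W(R²s, Ry + x)` is again Type-I ancient mild with the SAME constant (`IsTypeIAncientMild.nsRescale`,
`.comp_add_right`) and has all-time linear growth with the SAME `A` (change of variables `w = Ry + x`); its slice derivative is
`∇V(s)(y) = R²·∇W(R²s)(Ry + x)`, so `∫ |∇V(s)|²_F χ₁ = R ∫ |∇W(R²s)|²_F χ₁((· − x)/R)` and, substituting `t = R²s`,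
`∫_{τ₁}^{τ₂}∫ |∇W|²_F χ₁((·−x)/R) = R · ∫_{τ₁/R²}^{τ₂/R²}∫|∇V|²_F χ₁ ≤ R · C_u(A + KA + A√A)`; the measure glue
`dissMeasure_le_ofReal_integral` (with the cut-off `χ₁((·−x)/R) = 1` on `B(x,R)`) concludes.

HONEST FRAMING: a local energy budget for hypothetical Type-I ancient fields (the ledger's L1); the line's heart C1 and the crux 26567
remain OPEN; nothing about Navier–Stokes regularity or blow-up is proved; no summit is proved by a line.
[cite: KochNadirashviliSereginSverak2009, §1 (1.2) and §4 p. 8; CaffarelliKohnNirenberg1982, §2 (2.5)]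
-/

noncomputable section

open MeasureTheory Set Filter Metric Topology Function
open scoped ENNReal NNReal InnerProductSpace

namespace Summit.NavierStokesRegularity.NavierStokesRegularity.Theorems

set_option linter.dupNamespace false

namespace NearExtremalTransiencePerFlow.DissipationLedger

open Literature.Analysis Literature.Analysis.FluidPDE
open Summit.NavierStokesRegularity.NavierStokesRegularity.Theorems.NearExtremalTransiencePerFlow.TightOrChain (UniformDissipationBudget)

-- nested operator types
set_option maxSynthPendingDepth 3

/-! ### The zoom-translate `V(s,y) = R·W(R²s, Ry + x)` -/

/-- The zoom-translate of a Type-I ancient mild field is Type-I ancient mild with the same constant (translation covariance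
`IsTypeIAncientMild.comp_add_right`, parabolic scaling `IsTypeIAncientMild.nsRescale`). [cite: KochNadirashviliSereginSverak2009, §1 (1.2)] -/
theorem isTypeIAncientMild_zoomTranslate {K : ℝ} {W : ℝ → EuclideanSpace ℝ (Fin 3) → EuclideanSpace ℝ (Fin 3)}
    (hW : IsTypeIAncientMild K W) (x : EuclideanSpace ℝ (Fin 3)) {R : ℝ} (hR : 0 < R) :
    IsTypeIAncientMild K (fun s y => R • W (R ^ 2 * s) (R • y + x)) := by
  have h := (IsTypeIAncientMild.comp_add_right hW x).nsRescale hR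
  have e : FluidPDE.nsRescale R (fun t y => W t (y + x)) = fun s y => R • W (R ^ 2 * s) (R • y + x) := by
    funext s y; rfl
  rwa [e] at h

/-- Change of variables `w = R z + x` on balls: `∫_{B(y₀,ρ)} f(Rz + x) dz = R⁻³ ∫_{B(Ry₀ + x, Rρ)} f(w) dw` (`R > 0`). [folklore] -/
theorem setIntegral_ball_comp_smul_add (f : EuclideanSpace ℝ (Fin 3) → ℝ) (x y₀ : EuclideanSpace ℝ (Fin 3)) {R : ℝ} (hR : 0 < R)
    (ρ : ℝ) :
    ∫ z in ball y₀ ρ, f (R • z + x) = (R ^ 3)⁻¹ * ∫ w in ball (R • y₀ + x) (R * ρ), f w := by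
  -- as whole-space integrals of indicators
  have hpre : ∀ z : EuclideanSpace ℝ (Fin 3), z ∈ ball y₀ ρ ↔ R • z + x ∈ ball (R • y₀ + x) (R * ρ) := by
    intro z
    rw [mem_ball, mem_ball, dist_eq_norm, dist_eq_norm, show R • z + x - (R • y₀ + x) = R • (z - y₀) by
      rw [smul_sub]; abel, norm_smul, Real.norm_of_nonneg hR.le]
    constructor
    · intro h; exact mul_lt_mul_of_pos_left h hR
    · intro h; exact lt_of_mul_lt_mul_left h hR.le
  have e1 : ∫ z in ball y₀ ρ, f (R • z + x) = ∫ z, (ball (R • y₀ + x) (R * ρ)).indicator f (R • z + x) := by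
    rw [← integral_indicator measurableSet_ball]
    refine integral_congr_ae (Eventually.of_forall fun z => ?_)
    show (ball y₀ ρ).indicator (fun z => f (R • z + x)) z = (ball (R • y₀ + x) (R * ρ)).indicator f (R • z + x)
    by_cases hz : z ∈ ball y₀ ρ
    · rw [indicator_of_mem hz, indicator_of_mem ((hpre z).1 hz)]
    · rw [indicator_of_notMem hz, indicator_of_notMem (fun h => hz ((hpre z).2 h))]
  rw [e1]
  have e2 : ∫ z : EuclideanSpace ℝ (Fin 3), (ball (R • y₀ + x) (R * ρ)).indicator f (R • z + x) =
      (R ^ 3)⁻¹ * ∫ z : EuclideanSpace ℝ (Fin 3), (ball (R • y₀ + x) (R * ρ)).indicator f (z + x) := by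
    have h := Measure.integral_comp_smul_of_nonneg volume
      (fun z : EuclideanSpace ℝ (Fin 3) => (ball (R • y₀ + x) (R * ρ)).indicator f (z + x)) R (hR := hR.le)
    rw [finrank_euclideanSpace_fin] at h
    simpa only [smul_eq_mul] using h
  rw [e2, integral_add_right_eq_self (fun z => (ball (R • y₀ + x) (R * ρ)).indicator f z) x,
    integral_indicator measurableSet_ball]

/-- The zoom-translate has all-time linear growth with the SAME constant (`∫_{B(y₀,ρ)}|V(s)|² = R²·R⁻³ ∫_{B(Ry₀+x,Rρ)}|W(R²s)|² ≤ Aρ`).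
[folklore] -/
theorem hasLinGrowthAllTime_zoomTranslate {A : ℝ} {W : ℝ → EuclideanSpace ℝ (Fin 3) → EuclideanSpace ℝ (Fin 3)}
    (hgr : HasLinGrowthAllTime A W) (x : EuclideanSpace ℝ (Fin 3)) {R : ℝ} (hR : 0 < R) :
    HasLinGrowthAllTime A (fun s y => R • W (R ^ 2 * s) (R • y + x)) := by
  intro s hs y₀ ρ hρ
  have hs' : R ^ 2 * s < 0 := mul_neg_of_pos_of_neg (by positivity) hs
  have e : (fun z : EuclideanSpace ℝ (Fin 3) => ‖R • W (R ^ 2 * s) (R • z + x)‖ ^ 2) =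
      fun z => (fun w => R ^ 2 * ‖W (R ^ 2 * s) w‖ ^ 2) (R • z + x) := by
    funext z; rw [norm_smul, Real.norm_of_nonneg hR.le, mul_pow]
  show ∫ z in ball y₀ ρ, ‖R • W (R ^ 2 * s) (R • z + x)‖ ^ 2 ≤ A * ρ
  rw [e, setIntegral_ball_comp_smul_add (fun w => R ^ 2 * ‖W (R ^ 2 * s) w‖ ^ 2) x y₀ hR ρ, integral_const_mul]
  have h := hgr (R ^ 2 * s) hs' (R • y₀ + x) (R * ρ) (mul_pos hR hρ)
  have hR3 : (R ^ 3)⁻¹ * (R ^ 2 * (A * (R * ρ))) = A * ρ := by field_simp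
  calc (R ^ 3)⁻¹ * (R ^ 2 * ∫ w in ball (R • y₀ + x) (R * ρ), ‖W (R ^ 2 * s) w‖ ^ 2)
      ≤ (R ^ 3)⁻¹ * (R ^ 2 * (A * (R * ρ))) := by gcongr
    _ = A * ρ := hR3

/-- The slice derivative of the zoom-translate: `∇V(s)(y) = R² · ∇W(R²s)(Ry + x)`. [folklore] -/
theorem fderiv_zoomTranslate_slice {K : ℝ} {W : ℝ → EuclideanSpace ℝ (Fin 3) → EuclideanSpace ℝ (Fin 3)}
    (hW : IsTypeIAncientMild K W) (x : EuclideanSpace ℝ (Fin 3)) (R : ℝ) {s : ℝ} (hs : R ^ 2 * s < 0)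
    (y : EuclideanSpace ℝ (Fin 3)) :
    fderiv ℝ (fun y : EuclideanSpace ℝ (Fin 3) => R • W (R ^ 2 * s) (R • y + x)) y =
      (R ^ 2) • fderiv ℝ (W (R ^ 2 * s)) (R • y + x) := by
  set g := W (R ^ 2 * s) with hg
  have hgd : Differentiable ℝ g := (hW.contDiff_slice hs).differentiable (by simp)
  have h_aff : HasFDerivAt (fun y : EuclideanSpace ℝ (Fin 3) => R • y + x) (R • ContinuousLinearMap.id ℝ (EuclideanSpace ℝ (Fin 3))) y :=
    ((hasFDerivAt_id y).const_smul R).add_const x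
  have h_g : HasFDerivAt g (fderiv ℝ g (R • y + x)) (R • y + x) := (hgd _).hasFDerivAt
  have hcomp : HasFDerivAt (fun y : EuclideanSpace ℝ (Fin 3) => R • g (R • y + x))
      (R • (fderiv ℝ g (R • y + x)).comp (R • ContinuousLinearMap.id ℝ (EuclideanSpace ℝ (Fin 3)))) y :=
    (h_g.comp y h_aff).const_smul R
  rw [hcomp.fderiv, ContinuousLinearMap.comp_smul, ContinuousLinearMap.comp_id, smul_smul, pow_two]

/-- **The localised dissipation of a slice of the zoom-translate**: `∫ |∇V(s)|²_F χ₁ = R ∫ |∇W(R²s)|²_F (w) χ₁((w−x)/R) dw`. [folklore] -/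
theorem integral_frobenius_zoomTranslate {K : ℝ} {W : ℝ → EuclideanSpace ℝ (Fin 3) → EuclideanSpace ℝ (Fin 3)}
    (hW : IsTypeIAncientMild K W) (x : EuclideanSpace ℝ (Fin 3)) {R : ℝ} (hR : 0 < R) {s : ℝ} (hs : s < 0) :
    ∫ y, frobeniusNormSq (fderiv ℝ (fun y : EuclideanSpace ℝ (Fin 3) => R • W (R ^ 2 * s) (R • y + x)) y) *
        (cutoff (1 : ℝ) : EuclideanSpace ℝ (Fin 3) → ℝ) y =
      R * ∫ w, frobeniusNormSq (fderiv ℝ (W (R ^ 2 * s)) w) * cutoff (1 : ℝ) (R⁻¹ • (w - x)) := by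
  have hs' : R ^ 2 * s < 0 := mul_neg_of_pos_of_neg (by positivity) hs
  have hR0 : R ≠ 0 := hR.ne'
  -- `|c L|² = c² |L|²`
  have hfrob : ∀ (c : ℝ) (L : EuclideanSpace ℝ (Fin 3) →L[ℝ] EuclideanSpace ℝ (Fin 3)),
      frobeniusNormSq (c • L) = c ^ 2 * frobeniusNormSq L := by
    intro c L
    unfold frobeniusNormSq
    rw [Finset.mul_sum]
    refine Finset.sum_congr rfl fun i _ => ?_
    rw [show (c • L) (stdOrthonormalBasis ℝ (EuclideanSpace ℝ (Fin 3)) i) = c • L (stdOrthonormalBasis ℝ (EuclideanSpace ℝ (Fin 3)) i)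
      from rfl, norm_smul, mul_pow, Real.norm_eq_abs, sq_abs]
  -- rewrite the integrand as `g (R • y)` with `g z = R⁴ |∇W(t)(z + x)|² χ₁(R⁻¹ z)`
  set g : EuclideanSpace ℝ (Fin 3) → ℝ := fun z =>
    R ^ 4 * (frobeniusNormSq (fderiv ℝ (W (R ^ 2 * s)) (z + x)) * cutoff (1 : ℝ) (R⁻¹ • z)) with hgdef
  have e1 : (fun y : EuclideanSpace ℝ (Fin 3) => frobeniusNormSq (fderiv ℝ (fun y : EuclideanSpace ℝ (Fin 3) =>
      R • W (R ^ 2 * s) (R • y + x)) y) * (cutoff (1 : ℝ) : EuclideanSpace ℝ (Fin 3) → ℝ) y) = fun y => g (R • y) := by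
    funext y
    rw [fderiv_zoomTranslate_slice hW x R hs' y, hfrob, hgdef]
    dsimp only
    rw [smul_smul, inv_mul_cancel₀ hR0, one_smul]
    ring
  rw [e1]
  have e2 : ∫ y : EuclideanSpace ℝ (Fin 3), g (R • y) = (R ^ 3)⁻¹ * ∫ z, g z := by
    have h := Measure.integral_comp_smul_of_nonneg volume g R (hR := hR.le)
    rw [finrank_euclideanSpace_fin] at h
    simpa only [smul_eq_mul] using h
  rw [e2, hgdef, integral_const_mul]
  have e3 : ∫ z : EuclideanSpace ℝ (Fin 3), frobeniusNormSq (fderiv ℝ (W (R ^ 2 * s)) (z + x)) * cutoff (1 : ℝ) (R⁻¹ • z) =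
      ∫ w : EuclideanSpace ℝ (Fin 3), frobeniusNormSq (fderiv ℝ (W (R ^ 2 * s)) w) * cutoff (1 : ℝ) (R⁻¹ • (w - x)) := by
    have h := integral_sub_right_eq_self (μ := (volume : Measure (EuclideanSpace ℝ (Fin 3))))
      (fun w : EuclideanSpace ℝ (Fin 3) => frobeniusNormSq (fderiv ℝ (W (R ^ 2 * s)) w) * cutoff (1 : ℝ) (R⁻¹ • (w - x))) (-x)
    simp only [sub_neg_eq_add, add_sub_cancel_right] at h
    exact h
  rw [e3, ← mul_assoc]
  congr 1
  rw [show R ^ 4 = R ^ 3 * R by ring, ← mul_assoc, inv_mul_cancel₀ (pow_ne_zero 3 hR0), one_mul]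

/-! ### The budget of every parabolic cylinder -/

/-- **The dissipation budget of every parabolic cylinder**: with the constant `C_u` of the unit cylinder,
`dissMeasure W ([τ₁,τ₂] × B(x,R)) ≤ C_u (A + KA + A√A) · R` for `τ₁ < τ₂ < 0`, `R > 0`, `−τ₁ ≤ R²` (zoom-translate to the unit
cylinder, substitute back, measure glue with the cut-off `χ₁((·−x)/R)`). [cite: CaffarelliKohnNirenberg1982, §2 (2.5)] -/
theorem dissipation_cylinder_le :
    ∃ C_u : ℝ, 0 ≤ C_u ∧ ∀ (K A : ℝ) (W : ℝ → EuclideanSpace ℝ (Fin 3) → EuclideanSpace ℝ (Fin 3)),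
      IsTypeIAncientMild K W → HasLinGrowthAllTime A W →
      ∀ (x : EuclideanSpace ℝ (Fin 3)) (R τ₁ τ₂ : ℝ), 0 < R → τ₁ < τ₂ → τ₂ < 0 → -τ₁ ≤ R ^ 2 →
        dissMeasure W (Icc τ₁ τ₂ ×ˢ ball x R) ≤ ENNReal.ofReal (C_u * (A + K * A + A * Real.sqrt A) * R) := by
  obtain ⟨C_u, hC0, hC⟩ := unitCylinder_dissipationIntegral_le
  refine ⟨C_u, hC0, fun K A W hW hgr x R τ₁ τ₂ hR h12 h2 h1 => ?_⟩
  have hR0 : R ≠ 0 := hR.ne'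
  have hR2 : 0 < R ^ 2 := by positivity
  -- the zoom-translate and the unit-cylinder bound for it
  set V : ℝ → EuclideanSpace ℝ (Fin 3) → EuclideanSpace ℝ (Fin 3) := fun s y => R • W (R ^ 2 * s) (R • y + x) with hV
  have hVcl : IsTypeIAncientMild K V := isTypeIAncientMild_zoomTranslate hW x hR
  have hVgr : HasLinGrowthAllTime A V := hasLinGrowthAllTime_zoomTranslate hgr x hR
  have h12' : τ₁ / R ^ 2 < τ₂ / R ^ 2 := div_lt_div_of_pos_right h12 hR2
  have h2' : τ₂ / R ^ 2 < 0 := div_neg_of_neg_of_pos h2 hR2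
  have h1' : -(τ₁ / R ^ 2) ≤ 1 := by
    rw [← neg_div, div_le_one hR2]; exact h1
  have hunit := hC K A V hVcl hVgr (τ₁ / R ^ 2) (τ₂ / R ^ 2) h12' h2' h1'
  -- the rescaled cut-off
  set φ : EuclideanSpace ℝ (Fin 3) → ℝ := fun w => cutoff (1 : ℝ) (R⁻¹ • (w - x)) with hφ
  have hlin : Continuous fun w : EuclideanSpace ℝ (Fin 3) => R⁻¹ • (w - x) := by fun_prop
  have hφc : Continuous φ := (contDiff_cutoff (n := 0) 1).continuous.comp hlin
  have hφ0 : ∀ w, 0 ≤ φ w := fun w => cutoff_nonneg 1 _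
  have hφ1 : ∀ w ∈ ball x R, φ w = 1 := by
    intro w hw
    rw [hφ]; dsimp only
    refine cutoff_eq_one one_pos ?_
    rw [norm_smul, norm_inv, Real.norm_of_nonneg hR.le]
    rw [mem_ball, dist_eq_norm] at hw
    rw [inv_mul_le_iff₀ hR]; linarith
  have hφcs : HasCompactSupport φ := by
    refine HasCompactSupport.intro (isCompact_closedBall x (2 * R)) fun w hw => ?_
    rw [mem_closedBall, dist_eq_norm, not_le] at hw
    rw [hφ]; dsimp only
    refine cutoff_eq_zero one_pos ?_
    rw [norm_smul, norm_inv, Real.norm_of_nonneg hR.le, le_inv_mul_iff₀ hR]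
    linarith
  -- substitute back: `∫_{τ₁}^{τ₂} ∫ |∇W|² φ = R · (unit-cylinder double integral of V)`
  have hslice : ∀ s ∈ uIcc (τ₁ / R ^ 2) (τ₂ / R ^ 2),
      ∫ y, frobeniusNormSq (fderiv ℝ (V s) y) * (cutoff (1 : ℝ) : EuclideanSpace ℝ (Fin 3) → ℝ) y =
        (fun t => R * ∫ w, frobeniusNormSq (fderiv ℝ (W t) w) * φ w) (R ^ 2 * s) := by
    intro s hs
    rw [uIcc_of_le h12'.le] at hs
    have hs0 : s < 0 := hs.2.trans_lt h2'
    exact integral_frobenius_zoomTranslate hW x hR hs0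
  have hsub : ∫ s in (τ₁ / R ^ 2)..(τ₂ / R ^ 2), ∫ y, frobeniusNormSq (fderiv ℝ (V s) y) *
      (cutoff (1 : ℝ) : EuclideanSpace ℝ (Fin 3) → ℝ) y = R⁻¹ * ∫ t in τ₁..τ₂, ∫ w, frobeniusNormSq (fderiv ℝ (W t) w) * φ w := by
    rw [intervalIntegral.integral_congr hslice,
      intervalIntegral.integral_comp_mul_left (fun t => R * ∫ w, frobeniusNormSq (fderiv ℝ (W t) w) * φ w) hR2.ne',
      mul_div_cancel₀ _ hR2.ne', mul_div_cancel₀ _ hR2.ne', intervalIntegral.integral_const_mul, smul_eq_mul]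
    have e : (R ^ 2)⁻¹ * R = R⁻¹ := by
      rw [pow_two, mul_inv, mul_assoc, inv_mul_cancel₀ hR0, mul_one]
    rw [← mul_assoc, e]
  have hmain : ∫ t in τ₁..τ₂, ∫ w, frobeniusNormSq (fderiv ℝ (W t) w) * φ w ≤ C_u * (A + K * A + A * Real.sqrt A) * R := by
    have h := hunit
    rw [hsub] at h
    rw [inv_mul_le_iff₀ hR] at h
    linarith
  exact (dissMeasure_le_ofReal_integral hW h12 h2 x R hφc hφcs hφ0 hφ1).trans (ENNReal.ofReal_le_ofReal hmain)

/-- **Stub L1 of LINE g10-α `dissipation_ledger` — `DissipationBudget`, PROVED** (registered on stmt-NavierStokesRegularity-26567; the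
statement is the texts-of-record `DissipationBudget`): a Type-I ancient mild field with all-time linear growth `A` dissipates at most `E·R`
in every parabolic cylinder `[τ₁,τ₂] × B(x,R)` with `−τ₁ ≤ R²`, `E = C_u (A + K A + A√A)`.
[cite: CaffarelliKohnNirenberg1982, §2 (2.5); KochNadirashviliSereginSverak2009, §4 p. 8] -/
theorem stub_dissipationBudget :
    Summit.NavierStokesRegularity.NavierStokesRegularity.Theorems.NearExtremalTransiencePerFlow.DissipationLedger.DissipationBudget := by
  obtain ⟨C_u, hC0, hC⟩ := dissipation_cylinder_le
  intro K A W hW hgr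
  exact ⟨C_u * (A + K * A + A * Real.sqrt A), fun x R τ₁ τ₂ hR h12 h2 h1 => hC K A W hW hgr x R τ₁ τ₂ hR h12 h2 h1⟩

/-- **Stub L1ᵘ of LINES g10-β `tight_or_chain` / g10-γ `multiscale_crowding` — `UniformDissipationBudget`, PROVED** (the registered
stub `stub_uniformDissipationBudget` of the skeleton of record on stmt-NavierStokesRegularity-26567; texts of record
`…Theorems.NearExtremalTransiencePerFlow.TightOrChain.UniformDissipationBudget`): for all `K, A` ONE constant `E = C_u (A + K A + A√A)` serves
every Type-I ancient mild field with constant `K` and all-time linear growth `A`. [cite: CaffarelliKohnNirenberg1982, §2 (2.5)] -/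
theorem stub_uniformDissipationBudget : UniformDissipationBudget := by
  obtain ⟨C_u, hC0, hC⟩ := dissipation_cylinder_le
  intro K A
  exact ⟨C_u * (A + K * A + A * Real.sqrt A), fun W hW hgr x R τ₁ τ₂ hR h12 h2 h1 => hC K A W hW hgr x R τ₁ τ₂ hR h12 h2 h1⟩

end NearExtremalTransiencePerFlow.DissipationLedger

end Summit.NavierStokesRegularity.NavierStokesRegularity.Theorems

end
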